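import Mathlib
import Literature.MathematicalPhysics.QuantumFieldTheory.Luscher2010.TrivializingMaps
import Literature.MathematicalPhysics.QuantumFieldTheory.Luscher2010.FlowActionSeries
import Summits.Ventures.LatticeQCDFlow.TrivializingMaps.TruncationDefect
import Summits.Ventures.LatticeQCDFlow.TrivializingMaps.LogWeightDensity
import HarnessLib

/-!
# The order-`N` truncated Lüscher map: `TruncatedMapLogWeightBound` (weights within `e^{2K/(N+2)}`)

HONEST FRAMING: exact (Metropolis-corrected) sampling algorithms for lattice gauge theory; figures of merit are
autocorrelation/cost numbers at stated couplings and volumes; no continuum-physics claim.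

Lüscher §4.5(c): truncating the series `S̃_t = ∑ t^k S̃^{(k)}` at order `N` and integrating `Z_t = -∂S̃^{[N]}_t`
gives a map `𝓕_1` whose pulled-back action differs from the trivial one by a remainder of order `t^{N+1}`. This
file makes the statement quantitative and closes the venture's typed target `TruncatedMapLogWeightBound`
(`Truncation.lean` §3) CONDITIONALLY on the two cited analytic statements of §3 (`FlowGlobalExistence`,
`JacobianFormula`, named facts of the Literature file), exactly as `DefectLogWeightMeasure.lean` did for
`DefectControlsLogWeight`:
* §1 `logWeight_osc_le_of_defect_le`: a TIME-WEIGHTED defect bound `|𝓛_t S̃_t - S - Ċ_t| ≤ g(t)` gives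
  log-weight oscillation `≤ 2∫₀¹ g` (the FTC identity (3.2)+(4.3) ⇒ (4.1) in defect form, `‖∫f‖ ≤ ∫g`);
* §2 by the PROVED identity `TruncationDefectIdentity` (`TruncationDefect.lean`) the defect of the order-`N`
  truncation is exactly `t^{N+1} 𝓥 S̃^{(N)}`, so `g(t) = t^{N+1} K` with `K = sup |𝓥 S̃^{(N)}|` and
  `2∫₀¹ g = 2K/(N+2)`; the truncated flow action is jointly smooth;
* §3 `truncatedMapLogWeightBound_of : FlowGlobalExistence d L n → JacobianFormula d L n →
  TruncatedMapLogWeightBound d L n` via the master theorem `exists_density_of_logWeight_osc` (`LogWeightDensity.lean`).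
With `K ≤ b_N · |E|` (`ExtensiveDefect`, §4 of `Truncation.lean`, open) this is the `e^{-2 b_N |E| β^{N+2}/(N+2)}`
acceptance floor of the order-`N` Lüscher map at coupling `β` — the quantitative volume law behind §4.5(c)/§6.

References: M. Lüscher, Trivializing maps, the Wilson flow and the HMC algorithm, CMP 293 (2010) 899
[Luscher2010Trivializing, arXiv:0907.5491], §3.2 eq. (3.9), §4.1 eqs. (4.1)–(4.3), §4.3 eqs. (4.11)–(4.15),
§4.5(c).
-/

namespace Summit.Ventures.LatticeQCDFlow.TrivializingMaps

open MeasureTheory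
open Literature.MathematicalPhysics.QuantumFieldTheory
open Literature.MathematicalPhysics.QuantumFieldTheory.Luscher2010
open scoped Matrix Matrix.Norms.Frobenius ContDiff

variable {d L n : ℕ}

/-! ## §1. A time-weighted defect bound controls the log-weight oscillation -/

section Weighted

variable [NeZero L]

/-- Two reals within `δ` of a common third are within `2δ` of each other. [folklore] -/
private theorem abs_sub_le_two_mul' {x y z δ : ℝ} (hx : |x - z| ≤ δ) (hy : |y - z| ≤ δ) :
    |x - y| ≤ 2 * δ := by
  rw [abs_le] at hx hy ⊢
  constructor <;> linarith [hx.1, hx.2, hy.1, hy.2]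

/-- **Time-weighted form of `logWeight_osc_le_of_defect`** (OURS): if the flow-equation defect of the gradient
ansatz satisfies `|(𝓛_t S̃_t)(U) - S(U) - Ċ_t| ≤ g(t)` on `[0,1] × SU(n)^E` with `g` integrable, then the
log-weight `R(V) = ∫₀¹ div Z_s(𝓕_s V) ds - S(𝓕_1 V)` oscillates by at most `2 ∫₀¹ g`. (For the order-`N` Lüscher
truncation `g(t) = t^{N+1} K`, `∫₀¹ g = K/(N+2)`, §2.) The proof is the FTC identity (3.2)+(4.3) ⇒ (4.1) in
defect form (`integral_linkDiv_flowLine`) and `‖∫ f‖ ≤ ∫ g`.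
[cite: Luscher2010Trivializing, §3.2 eq. (3.9), §4.1 eqs. (4.1)–(4.3), §4.5(c)] -/
theorem logWeight_osc_le_of_defect_le (B : SuBasis n) {S : AmbConfig d L n → ℝ} (hS : ContDiff ℝ ∞ S)
    {F : ℝ → AmbConfig d L n → ℝ} (hF : ContDiff ℝ ∞ fun p : ℝ × AmbConfig d L n => F p.1 p.2)
    {Φ : ℝ → GaugeConfig d L (Matrix.specialUnitaryGroup (Fin n) ℂ) →
      GaugeConfig d L (Matrix.specialUnitaryGroup (Fin n) ℂ)}
    (hΦ : IsFlowMap (fun t W => -linkGrad B (F t) W) Φ) {c g : ℝ → ℝ}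
    (hg : IntervalIntegrable g volume 0 1)
    (hδ : ∀ t ∈ Set.Icc (0 : ℝ) 1, ∀ U : GaugeConfig d L (Matrix.specialUnitaryGroup (Fin n) ℂ),
      |luscherL B S t (F t) (WilsonFlow.coeConfig U) - S (WilsonFlow.coeConfig U) - c t| ≤ g t)
    (V V' : GaugeConfig d L (Matrix.specialUnitaryGroup (Fin n) ℂ)) :
    |((∫ s in (0 : ℝ)..1, linkDiv B (fun W => -linkGrad B (F s) W) (WilsonFlow.coeConfig (Φ s V))) -
        S (WilsonFlow.coeConfig (Φ 1 V))) -
      ((∫ s in (0 : ℝ)..1, linkDiv B (fun W => -linkGrad B (F s) W) (WilsonFlow.coeConfig (Φ s V'))) -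
        S (WilsonFlow.coeConfig (Φ 1 V')))| ≤ 2 * ∫ s in (0 : ℝ)..1, g s := by
  have hid : ∀ V₀ : GaugeConfig d L (Matrix.specialUnitaryGroup (Fin n) ℂ),
      (∫ s in (0 : ℝ)..1, linkDiv B (fun W => -linkGrad B (F s) W) (WilsonFlow.coeConfig (Φ s V₀))) -
          S (WilsonFlow.coeConfig (Φ 1 V₀)) =
        ∫ s in (0 : ℝ)..1, (luscherL B S s (F s) (WilsonFlow.coeConfig (Φ s V₀)) -
          S (WilsonFlow.coeConfig (Φ s V₀))) := by
    intro V₀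
    rw [integral_linkDiv_flowLine B hS hF (hΦ.2 V₀) 1, one_mul]
    ring
  have hcont : ∀ V₀ : GaugeConfig d L (Matrix.specialUnitaryGroup (Fin n) ℂ), Continuous fun s =>
      luscherL B S s (F s) (WilsonFlow.coeConfig (Φ s V₀)) - S (WilsonFlow.coeConfig (Φ s V₀)) := by
    intro V₀
    have hUc := continuous_iff_continuousAt.2 fun s => (isFlowLine_hasDerivAt_amb (hΦ.2 V₀) s).continuousAt
    have hpair := continuous_iff_continuousAt.2 fun s =>
      (isFlowLine_hasDerivAt_graph (hΦ.2 V₀) s).continuousAt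
    exact ((contDiff_luscherL_param B hS hF).continuous.comp hpair).sub (hS.continuous.comp hUc)
  rw [hid V, hid V', ← intervalIntegral.integral_sub ((hcont V).intervalIntegrable _ _)
    ((hcont V').intervalIntegrable _ _), ← intervalIntegral.integral_const_mul]
  have hb := intervalIntegral.norm_integral_le_of_norm_le (μ := volume) zero_le_one
    (f := fun s => (luscherL B S s (F s) (WilsonFlow.coeConfig (Φ s V)) - S (WilsonFlow.coeConfig (Φ s V))) -
      (luscherL B S s (F s) (WilsonFlow.coeConfig (Φ s V')) - S (WilsonFlow.coeConfig (Φ s V'))))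
    (g := fun s => 2 * g s)
    (Filter.Eventually.of_forall fun s hs => by
      rw [Real.norm_eq_abs]
      exact abs_sub_le_two_mul' (hδ s (Set.Ioc_subset_Icc_self hs) (Φ s V))
        (hδ s (Set.Ioc_subset_Icc_self hs) (Φ s V')))
    (hg.const_mul 2)
  rw [Real.norm_eq_abs] at hb
  exact hb

end Weighted

/-! ## §2. The order-`N` truncated Lüscher map: defect `t^{N+1} 𝓥 S̃^{(N)}`, weight `e^{2K/(N+2)}` -/

section Truncated

variable [NeZero L]

/-- Joint smoothness of the truncated flow action `(t, W) ↦ S̃^{[N]}_t(W) = ∑_{k≤N} t^k S̃^{(k)}(W)` for smooth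
orders. [cite: Luscher2010Trivializing, §4.5(c)] -/
theorem contDiff_truncFlowAction_param {Sk : ℕ → AmbConfig d L n → ℝ} (hSk : ∀ k, ContDiff ℝ ∞ (Sk k))
    (N : ℕ) : ContDiff ℝ ∞ fun p : ℝ × AmbConfig d L n => truncFlowAction Sk p.1 N p.2 := by
  show ContDiff ℝ ∞ fun p : ℝ × AmbConfig d L n => ∑ k ∈ Finset.range (N + 1), p.1 ^ k * Sk k p.2
  exact ContDiff.sum fun k _ => (contDiff_fst.pow k).mul ((hSk k).comp contDiff_snd)

/-- **The defect of the order-`N` truncation is `t^{N+1} 𝓥 S̃^{(N)}`** (from the proved typed target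
`TruncationDefectIdentity`): with `Ċ_t := ∑_{k≤N} t^k Ċ^{(k)}`,
`|(𝓛_t S̃^{[N]}_t)(U) - S(U) - Ċ_t| ≤ t^{N+1} K` on `[0,1] × SU(n)^E` whenever `sup |𝓥 S̃^{(N)}| ≤ K`.
[cite: Luscher2010Trivializing, §4.3 eqs. (4.11)–(4.13), §4.5(c)] -/
theorem abs_truncation_defect_le (B : SuBasis n) {S : AmbConfig d L n → ℝ} (hS : ContDiff ℝ ∞ S)
    {Sk : ℕ → AmbConfig d L n → ℝ} (hSk : ∀ k, ContDiff ℝ ∞ (Sk k)) {c : ℕ → ℝ}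
    (hser : IsLuscherSeries B S Sk c) (N : ℕ) {K : ℝ}
    (hK : ∀ U : GaugeConfig d L (Matrix.specialUnitaryGroup (Fin n) ℂ),
      |luscherV B S (Sk N) (WilsonFlow.coeConfig U)| ≤ K)
    (t : ℝ) (ht : t ∈ Set.Icc (0 : ℝ) 1) (U : GaugeConfig d L (Matrix.specialUnitaryGroup (Fin n) ℂ)) :
    |luscherL B S t (truncFlowAction Sk t N) (WilsonFlow.coeConfig U) - S (WilsonFlow.coeConfig U) -
        ∑ k ∈ Finset.range (N + 1), t ^ k * c k| ≤ t ^ (N + 1) * K := by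
  rw [truncationDefectIdentity_holds B S Sk c hS hSk hser t N U,
    show S (WilsonFlow.coeConfig U) + (∑ k ∈ Finset.range (N + 1), t ^ k * c k) +
        t ^ (N + 1) * luscherV B S (Sk N) (WilsonFlow.coeConfig U) - S (WilsonFlow.coeConfig U) -
        ∑ k ∈ Finset.range (N + 1), t ^ k * c k = t ^ (N + 1) * luscherV B S (Sk N) (WilsonFlow.coeConfig U)
      by ring, abs_mul, abs_of_nonneg (pow_nonneg ht.1 _)]
  exact mul_le_mul_of_nonneg_left (hK U) (pow_nonneg ht.1 _)

/-- `2 ∫₀¹ t^{N+1} K dt = 2K/(N+2)`. [folklore] -/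
private theorem two_mul_integral_pow_mul (N : ℕ) (K : ℝ) :
    2 * ∫ s in (0 : ℝ)..1, s ^ (N + 1) * K = 2 * K / (N + 2) := by
  rw [intervalIntegral.integral_mul_const, integral_pow]
  have h : ((N : ℝ) + 1 + 1) ≠ 0 := by positivity
  push_cast
  field_simp
  ring

end Truncated

section Target

/-- **Log-weight bound for the truncated trivializing map** (typed target `TruncatedMapLogWeightBound` of
`Truncation.lean` §3; Lüscher §4.5(c) made quantitative), *conditionally on* the two cited analytic inputs of
§3 (`FlowGlobalExistence`, `JacobianFormula`): if `Φ` integrates `Z_t = -∂S̃^{[N]}_t` for a smooth Lüscher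
series of a smooth action and `sup_{SU(n)^E} |𝓥 S̃^{(N)}| ≤ K`, then `(Φ₁)_* D[V] = ρ · 𝒵⁻¹e^{-S} D[U]` with
`ρ > 0` measurable and `ρ(U) ≤ e^{2K/(N+2)} ρ(U')` — so Metropolis acceptance and importance weights of the
order-`N` map are controlled by `e^{-2K/(N+2)}`. Chain: `TruncationDefectIdentity` (defect `= t^{N+1}𝓥S̃^{(N)}`)
→ `logWeight_osc_le_of_defect_le` (`|R(V) - R(V')| ≤ 2K/(N+2)`) → `exists_density_of_logWeight_osc`.
[cite: Luscher2010Trivializing, §3.2 eq. (3.9), §4.1 eqs. (4.1)–(4.3), §4.3, §4.5(c)] -/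
theorem truncatedMapLogWeightBound_of (hGE : FlowGlobalExistence d L n) (hJ : JacobianFormula d L n) :
    TruncatedMapLogWeightBound d L n := by
  intro _ B S Sk c N Φ K hS hSk hser hΦ hmeas hK
  have hF := contDiff_truncFlowAction_param hSk N
  have hg : IntervalIntegrable (fun t : ℝ => t ^ (N + 1) * K) volume 0 1 :=
    ((continuous_pow (N + 1)).mul continuous_const).intervalIntegrable 0 1
  have hosc := logWeight_osc_le_of_defect_le B hS (F := fun t => truncFlowAction Sk t N) hF hΦ hg
    (fun t ht U => abs_truncation_defect_le B hS hSk hser N hK t ht U)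
  exact exists_density_of_logWeight_osc hGE hJ B hS (F := fun t => truncFlowAction Sk t N) hF hΦ (hmeas 1)
    fun V V' => (hosc V V').trans_eq (two_mul_integral_pow_mul N K)

end Target

end Summit.Ventures.LatticeQCDFlow.TrivializingMaps
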